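import Summits.FinalStateConjecture.FinalStateConjecture.Theorems.EIHFluxBalanceModulatedKerrHandoffStubSphericalMeansCalculusC2
import Summits.FinalStateConjecture.FinalStateConjecture.Theorems.EIHFluxBalanceModulatedKerrHandoffStubKirchhoffComparisonC2
import Summits.FinalStateConjecture.FinalStateConjecture.Theorems.EIHFluxBalanceModulatedKerrHandoffStubRetardedConeEstimate

/-!
# Route EIHFluxBalance — crux `ModulatedKerrHandoff`, line `cone-rates-are-iled`: the card's FIRST LEMMA

`stub_lieDragResponseDecay` (the line's original registered stub S2, statement byte-identical with the
skeleton's `LieDragResponseDecay` / `lieDragResponseDecay_proof`): for the flat forced `1+3` wave equation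
`∂ₜ²u = Δu + f` (`u ∈ C²(ℝ × E3)`, `f` continuous) with zero Cauchy data at `t = 1` and a source supported in
the lab cone `‖x‖ ≤ κt` and dominated by the Lie-dragged two-centre profile
`A t⁻²[(M + ‖x − ½vt e₁‖)⁻² + (M + ‖x + ½vt e₁‖)⁻²]`, the response is `O(A log(1+t)/t²)` in the cone.
Composition of the three landed pieces: Kirchhoff–Duhamel comparison for `C²` solutions
(`stub_kirchhoffComparisonC2`, fed by the `C²` spherical-means calculus `stub_sphericalMeansCalculusC2`)
and the retarded-cone estimate (`stub_retardedConeEstimate`).  No definitions, no named facts.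
-/

noncomputable section

open scoped Manifold ContDiff Topology ENNReal BigOperators
open Filter Set MeasureTheory Metric Function Literature.Geometry.Lorentzian

-- the doubled `FinalStateConjecture.FinalStateConjecture` path component trips dupNamespace
set_option linter.dupNamespace false
set_option linter.style.longLine false

namespace Summit.FinalStateConjecture.FinalStateConjecture.Theorems.EIHFluxBalance.ConeRatesAreILED

/-- **The card's first lemma `LieDragResponseDecay`** (line `cone-rates-are-iled`, crux
`EIHFluxBalance.ModulatedKerrHandoff`; registered stub `stub_lieDragResponseDecay`): the flat forced
response to a continuous source supported in the lab cone `‖x‖ ≤ κt` and bounded by the Lie-dragged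
two-centre profile `A t⁻²Σ±(M + ‖x ∓ ½vt e₁‖)⁻²`, with zero Cauchy data at `t = 1`, is
`O(A log(1+t)/t²)` in the cone, for every `C²` solution (no growth conditions: domain of dependence).
Proof: `|u(t,x)| ≤ σ(S²)⁻¹∫₀^{t-1} s∫_{S²}|f(t-s, x+sw)| dσ ds` (Kirchhoff–Duhamel for `C²` data, zero data)
and the retarded-cone estimate of that integral. [folklore] -/
theorem stub_lieDragResponseDecay :
    ∀ (A M v κ : ℝ), 0 ≤ A → 0 < M → 0 < v → v < κ → κ < 1 → ∃ C : ℝ, ∀ (u f : ℝ → E3 → ℝ), ContDiff ℝ 2 (fun p : ℝ × E3 ↦ u p.1 p.2) → Continuous (fun p : ℝ × E3 ↦ f p.1 p.2) → (∀ x, u 1 x = 0 ∧ deriv (fun s ↦ u s x) 1 = 0) → (∀ t x, 1 ≤ t → deriv (fun s ↦ deriv (fun s' ↦ u s' x) s) t = ∑ i : Fin 3, deriv (fun s : ℝ ↦ deriv (fun s' : ℝ ↦ u t (x + s' • EuclideanSpace.single i (1 : ℝ))) s) (0 : ℝ) + f t x) → (∀ t x, 1 ≤ t → κ * t < ‖x‖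 → f t x = 0) → (∀ t x, 1 ≤ t → |f t x| ≤ A * t⁻¹ ^ 2 * ((M + ‖x - (v * t / 2) • EuclideanSpace.single (0 : Fin 3) (1 : ℝ)‖)⁻¹ ^ 2 + (M + ‖x + (v * t / 2) • EuclideanSpace.single (0 : Fin 3) (1 : ℝ)‖)⁻¹ ^ 2)) → ∀ t x, 1 ≤ t → ‖x‖ ≤ κ * t → |u t x| ≤ C * A * Real.log (1 + t) / t ^ 2 := by
  intro A M v κ hA hM hv hvκ hκ
  obtain ⟨C, hC⟩ := stub_retardedConeEstimate A M v κ hA hM hv hvκ hκ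
  refine ⟨C, fun u f hu hf h0 hpde hsupp hbd t x ht hx ↦ ?_⟩
  exact (stub_kirchhoffComparisonC2 stub_sphericalMeansCalculusC2 u f hu hf h0 hpde t x ht).trans
    (hC f hf hsupp hbd t x ht hx)

end Summit.FinalStateConjecture.FinalStateConjecture.Theorems.EIHFluxBalance.ConeRatesAreILED

end
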